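import Literature.Analysis.FunctionSpaces.PoissonPointProcessProofs
import Literature.Analysis.FunctionSpaces.PoissonPointProcessUniqueness
import HarnessLib

/-!
# Poisson point processes: translation invariance in law
(topic Analysis/FunctionSpaces; DISCHARGES the named fact
`Literature.Analysis.FunctionSpaces.IsPoissonPointProcess.map_translate` of
`Literature.Analysis.FunctionSpaces.PoissonPointProcess` as `IsPoissonPointProcess.map_translate_holds`)

Main result: `IsPoissonPointProcess.map_translate_holds` — if `P` is (the law of) a Poisson point
process on `E` with σ-finite intensity `ν` (Kingman's axioms, `IsPoissonPointProcess ν P`) and `ν`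
is invariant under the translation `x ↦ x + v` (`ν.map (· + v) = ν`, e.g. `ν` a Haar measure),
then the law is invariant under translation of configurations: `P.map (translate v) = P`.

This is the statement of Kingman, *Poisson Processes* (1993), §2.1, p. 13 — the homogeneous
process "has stochastic properties which are unchanged under translations" — and of Last–Penrose,
*Lectures on the Poisson Process* (2017), Proposition 8.3, whose printed proof is exactly the one
formalised here: "we need only to show that … `θ_x η` has the same distribution as `η` … Since
`θ_x` preserves [the intensity], this follows from Theorem 5.1 (the mapping theorem)", the
identification of the two laws being Proposition 3.2 (uniqueness of the Poisson process with a
given s-finite, here σ-finite, intensity). Concretely: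

* by the Mapping Theorem for translations (`IsPoissonPointProcess.translate_holds`,
  `PoissonPointProcessProofs.lean`; Kingman 1993, §2.3) the translated law `P.map (translate v)`
  is a Poisson point process with intensity `ν.map (· + v) = ν`;
* by uniqueness in law for a σ-finite intensity (`IsPoissonPointProcess.unique_holds`,
  `PoissonPointProcessUniqueness.lean`; Rényi 1967, Kingman 1993, §2.1 (2.5), Last–Penrose
  Prop. 3.2) it therefore coincides with `P`.

This file is a separate leaf because it needs both companions of `PoissonPointProcess.lean`.
No new definitions, no new named facts.

## References

* J. F. C. Kingman, *Poisson Processes*, Oxford Studies in Probability 3, Oxford University Press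
  (1993), §2.1, p. 13; §2.3 The Mapping Theorem, pp. 17–18.
* G. Last, M. Penrose, *Lectures on the Poisson Process*, IMS Textbooks 7, Cambridge University
  Press (2017), Proposition 3.2, Theorem 5.1, Definition 8.1, Proposition 8.3.
-/

open MeasureTheory

namespace Literature.Analysis.FunctionSpaces

variable {E : Type*} [TopologicalSpace E] [MeasurableSpace E]

namespace IsPoissonPointProcess

variable {ν : Measure E} {P : Measure (PointConfig E)}

/-- **Translation invariance in law** (discharge of the named fact
`IsPoissonPointProcess.map_translate`): a Poisson point process whose σ-finite intensity is
invariant under `x ↦ x + v` has a law invariant under translation of configurations by `v`.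
By `translate_holds` (Kingman's Mapping Theorem, §2.3) the translated law is again a Poisson point
process, with intensity `ν.map (· + v) = ν`, and by `unique_holds` (uniqueness in law for a
σ-finite intensity) it equals `P` (Kingman 1993, §2.1, p. 13: "unchanged under translations";
Last–Penrose 2017, Proposition 8.3, whose printed proof is "mapping theorem", given the uniqueness
Proposition 3.2). [cite: LastPenrose2017, Proposition 8.3] -/
theorem map_translate_holds : IsPoissonPointProcess.map_translate (ν := ν) (P := P) := by
  intro _ _ _ _ h v hν
  have h1 := translate_holds h v
  rw [hν] at h1
  exact unique_holds h1 h

end IsPoissonPointProcess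

end Literature.Analysis.FunctionSpaces
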